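import Literature.Analysis.FluidPDE.TorusNS2DGlobalExistence
import Summits.AnomalousDissipation.AnomalousDissipation.Theorems.SawtoothPulseCascadeK3LocalisedClosureExistenceAssembly
import HarnessLib

/-!
# K3loc, line `DriftFree` — STUB `stub_existence`: the existence package on the box

Registered stub `stub_existence` (skeleton v3.1, sha ea29348e…) of the crux `K3LocalisedClosure`
(stmt-AnomalousDissipation-19492), route `SawtoothPulseCascade`, line `DriftFree`:
`∀ γ ∈ Icc (5:ℝ) 8, ∀ ρN ∈ Finset.Icc 2 7, DriftFree.Existence ⟨γ, 1/4, 2, 1, ρN⟩` — for every `ν > 0` a global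
CLASSICAL planar Navier–Stokes solution on `[0,1) × 𝕋²` from rest forced by `∂ₜū`, the scalar it transports from
`sin 2πx₁`, the forced weak formulation of the `2½`-D lift on `[0,1]`, and the cascade scalar itself.

Proof = the lead's assembly `DriftFreeExistence.existence_of_windows` (p445153: closed windows glued along `[0,1)`,
scalars by the tree's well-posedness, weak lift by the force bound) fed with the literature seat's two-dimensional
global regularity theorem `Torus.exists_classicalNS_forced_fin_two` (Ladyzhenskaya 1959; ad-lit g9, p452019: uniform
restart theorem + a priori `H⁶`-type bounds on `𝕋²`) applied on each closed window `[0, τ] ⊂ [0,1)` with the cascade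
field `ū = P.field` itself as the potential of the force (`planarForce P = ∂ₜū` within `[0,1)` by definition), zero
datum.  No new mathematics here.
-/

-- `Summit.<Summit>.<Problem>`: single-conjunct summit, the duplicate namespace segment is deliberate.
set_option linter.dupNamespace false

noncomputable section

namespace Summit.AnomalousDissipation.AnomalousDissipation.Theorems.SawtoothPulseCascade.DriftFreeExistence

open scoped InnerProductSpace ENNReal NNReal
open MeasureTheory Set Filter Topology
open Literature.Analysis Literature.Analysis.FunctionSpaces Literature.Analysis.FluidPDE
open Literature.Analysis.FluidPDE.SawtoothCascade
open Literature.Analysis.FluidPDE.SawtoothCascade.DriftFree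

/-- **`Existence P` at every admissible parameter point** (`δ₀ > 0`, `d > 0`, `N₀ ≥ 1`, `ρN ≥ 2`): planar Navier–Stokes
forced by `planarForce P = ∂ₜū` is globally classically solvable from rest on every closed window `[0, τ] ⊂ [0,1)`
(`Torus.exists_classicalNS_forced_fin_two`, two-dimensional global regularity, with `ū = P.field` as the potential of
the force on the time set `[0,1)`), and `existence_of_windows` assembles the package. [cite: Ladyzhenskaya1959, Thm. 1] -/
theorem existence_of_params (P : CascadeParams) (hδ₀ : 0 < P.δ₀) (hd : 0 < P.d) (hN₀ : 1 ≤ P.N₀) (hρ : 2 ≤ P.ρN) :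
    Existence P := by
  refine existence_of_windows P hδ₀ hd hN₀ hρ fun ν hν τ hτ => ?_
  have hI : Icc 0 τ ⊆ Ico (0 : ℝ) 1 := fun s hs => ⟨hs.1, hs.2.trans_lt hτ.2⟩
  have h0s : FunctionSpaces.Torus.IsSmooth (0 : UnitAddTorus (Fin 2) → EuclideanSpace ℝ (Fin 2)) :=
    FunctionSpaces.Torus.isSmooth_const (0 : EuclideanSpace ℝ (Fin 2))
  have h0div : FunctionSpaces.Torus.IsDivFree (0 : UnitAddTorus (Fin 2) → EuclideanSpace ℝ (Fin 2)) := fun x => by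
    simp [FunctionSpaces.Torus.divergence, FunctionSpaces.Torus.partialDeriv, FunctionSpaces.Torus.lineDeriv]
  exact Torus.exists_classicalNS_forced_fin_two (S := Ico (0 : ℝ) 1) hν hτ.1 hI (cascadeFieldSmooth P hδ₀ hd)
    (fun t ht => isDivFree_field P (hI ht)) (fun t ht x => by simp [planarForce, (hI ht).2]) h0s h0div

/-- **STUB `stub_existence`** (line `DriftFree`, crux K3loc stmt-AnomalousDissipation-19492, skeleton v3.1): the existence
package `DriftFree.Existence` on the box `γ ∈ [5, 8]`, `ρN ∈ {2, …, 7}` (`δ₀ = 1/4`, `d = 2`, `N₀ = 1`) — by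
`existence_of_params`. [cite: Ladyzhenskaya1959, Thm. 1] -/
theorem stub_existence :
    ∀ γ ∈ Icc (5 : ℝ) 8, ∀ ρN ∈ Finset.Icc 2 7, Existence ⟨γ, 1 / 4, 2, 1, ρN⟩ := by
  intro γ _ ρN hρN
  exact existence_of_params ⟨γ, 1 / 4, 2, 1, ρN⟩ (by norm_num) (by norm_num) le_rfl (Finset.mem_Icc.1 hρN).1

end Summit.AnomalousDissipation.AnomalousDissipation.Theorems.SawtoothPulseCascade.DriftFreeExistence

end
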